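import Summits.AtomisticToContinuum.Crystallization.Theses.HolmgrenBoyleLind

/-!
# Route HolmgrenBoyleLind — item 6080 `Assembly`

Item `stmt-AtomisticToContinuum-6080` (assembly, rank 1) of route
`route-AtomisticToContinuum-HolmgrenBoyleLind`:

`HalfSpaceUniqueContinuation → HalfSpaceRigidityPeriodic → GroundStatesChargeFLCEquilibrium →
 ChargedPeriodicIsOptimal → ChargedPatternCrystallizes → CrysEnergyLimit → Crystallization`
(conclusion: the sub-problem decl `_root_.Crystallization`, an `abbrev` for
`Literature.MathematicalPhysics.StatisticalMechanics.Crystallization`).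

PROOF (pure bookkeeping over the six items plus two PROVED Literature facts; it is the same script
as the route file's planner-authored deciding theorem `…Theses.HolmgrenBoyleLind.closes`, repeated
here so that this file depends only on the item decls, not on that theorem):

* the hinge `GroundStatesChargePeriodic` is DERIVED from the three cruxes: given a ground-state
  sequence `x`, LIM (`GroundStatesChargeFLCEquilibrium`) gives one FLC Delone set `Λ` in force
  balance charged by `x`; UC (`HalfSpaceUniqueContinuation`) at `Λ` is literally the hull hypothesis
  of HSR (`HalfSpaceRigidityPeriodic`), so `Λ = P.points` for a periodic configuration `P` (`subst`),
  and the charging clause of LIM is the conclusion of `GroundStatesChargePeriodic` for `P`;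
* conjunct (ii) `IsCrystallizing lennardJones 3` is
  `ChargedPatternCrystallizes GroundStatesChargePeriodic LennardJonesMinimalDistance_holds`;
* conjunct (i) `HasPeriodicGroundStateEnergy lennardJones 3`: a sequence of ground states exists
  (`LennardJonesGroundStatesExist_holds`), its charged `Q` is optimal among periodic
  configurations by `ChargedPeriodicIsOptimal` (`IsLeast`), and `CrysEnergyLimit` rewritten with
  `IsLeast.csInf_eq` is `Tendsto (E(N)/N) (𝓝 e(Q))`.
-/

namespace Summit.AtomisticToContinuum.Crystallization.Theorems

open Filter Topology

/-- **Item 6080 `Assembly`** (route `HolmgrenBoyleLind`, by name): the six load-bearing items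
`HalfSpaceUniqueContinuation`, `HalfSpaceRigidityPeriodic`, `GroundStatesChargeFLCEquilibrium`,
`ChargedPeriodicIsOptimal`, `ChargedPatternCrystallizes`, `CrysEnergyLimit` imply the sub-problem
`Crystallization`.  Logic over the items plus the proved facts
`LennardJonesGroundStatesExist_holds` (a ground-state sequence to charge a periodic `Q`) and
`LennardJonesMinimalDistance_holds` (hard core `1/3`), with `IsLeast.csInf_eq` identifying
`⨅_Q' e(Q') = e(Q)`; same argument as the route's deciding theorem `closes`. [folklore] -/
theorem holmgrenBoyleLind_assembly_proof :
    Summit.AtomisticToContinuum.Crystallization.Theses.HolmgrenBoyleLind.Assembly := by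
  unfold Summit.AtomisticToContinuum.Crystallization.Theses.HolmgrenBoyleLind.Assembly
  intro hUC hHSR hLIM hOpt hCryst hLim
  -- the hinge `GroundStatesChargePeriodic`, DERIVED from the three cruxes LIM, UC, HSR
  have hGCP :
      Summit.AtomisticToContinuum.Crystallization.Theses.HolmgrenBoyleLind.GroundStatesChargePeriodic := by
    intro x hx
    obtain ⟨Λ, δ, r, hδ, hr, hsep, hden, hFLC, hbal, hch⟩ := hLIM x hx
    obtain ⟨P, hP⟩ := hHSR Λ δ r hδ hr hsep hden hFLC (hUC Λ δ r hδ hr hsep hden hFLC hbal)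
    subst hP
    exact ⟨P, hch⟩
  change Literature.MathematicalPhysics.StatisticalMechanics.HasPeriodicGroundStateEnergy
      Literature.MathematicalPhysics.StatisticalMechanics.lennardJones 3 ∧
    Literature.MathematicalPhysics.StatisticalMechanics.IsCrystallizing
      Literature.MathematicalPhysics.StatisticalMechanics.lennardJones 3
  refine ⟨?_, hCryst hGCP
    Literature.MathematicalPhysics.StatisticalMechanics.LennardJonesMinimalDistance_holds⟩
  -- energetic half: a ground-state sequence exists, its charged `Q` is optimal, and `⨅ = e(Q)`
  choose x hx using
    Literature.MathematicalPhysics.StatisticalMechanics.LennardJonesGroundStatesExist_holds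
  obtain ⟨Q, hQ⟩ := hGCP x hx
  have hleast := hOpt Q ⟨x, hx, hQ⟩
  refine ⟨Q, hleast, ?_⟩
  have h1 : (⨅ Q' : Literature.MathematicalPhysics.StatisticalMechanics.PeriodicConfiguration 3,
      Q'.energyPerParticle Literature.MathematicalPhysics.StatisticalMechanics.lennardJones) =
      Q.energyPerParticle Literature.MathematicalPhysics.StatisticalMechanics.lennardJones :=
    hleast.csInf_eq
  rw [← h1]
  exact hLim

end Summit.AtomisticToContinuum.Crystallization.Theorems
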